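import Mathlib.MeasureTheory.Integral.Bochner.Basic
import Literature.Probability.Percolation.Percolation

/-!
# Flipping one edge preserves Bernoulli(1/2) bond percolation
(helper for stub `stub_kirchhoff` of line `finitary-green-pairing`, crux `CoherentMorera`, stmt-CriticalPhenomena-11388)

`bondPercolation G half` is invariant under `ω ↦ ω ∆ {e}` for an edge `e` of `G`
(`bondPercolation_half_map_toggle`): the coordinate law at `e`, `½ δ_True + ½ δ_False`, is invariant
under negation and all other coordinates are untouched (Mathlib's `Measure.infinitePi_map_pi`).  Hence
`∫ F (ω ∆ {e}) dP_{1/2} = ∫ F dP_{1/2}` (`integral_toggle_half`) — the measure-theoretic half of the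
pairing `ω ↔ ω ∆ {e}` behind Duminil-Copin's vertex relation for percolation (q = 1: no cluster
weight, no FK weight ratio).
-/

noncomputable section

namespace Summit.CriticalPhenomena.CardyFormulaZ2.Cruxes.CoherentMorera.FinitaryGreenPairing

open MeasureTheory ProbabilityTheory Measure unitInterval
open scoped symmDiff
open Literature.Probability.Percolation

variable {V : Type*}

/-- The coordinate flip at `e`: `{i | q i ↔ i ≠ e} = {i | q i} ∆ {e}`. -/
theorem setOf_flipCoord_eq (e : Sym2 V) (q : Sym2 V → Prop) :
    {i | (q i ↔ i ≠ e)} = ({i | q i} : Set (Sym2 V)) ∆ {e} := by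
  ext i
  simp only [Set.mem_setOf_eq, Set.mem_symmDiff, Set.mem_singleton_iff]
  by_cases hi : i = e
  · simp [hi]
  · simp [hi]

/-- `ω ↦ ω ∆ {e}` is measurable. -/
theorem measurable_toggle (e : Sym2 V) : Measurable (fun ω : BondConfig V => ω ∆ {e}) := by
  refine measurable_set_iff.2 fun i => ?_
  by_cases hi : i = e
  · have : (fun ω : BondConfig V => i ∈ ω ∆ {e}) = fun ω => i ∉ ω := by
      funext ω; apply propext; simp [Set.mem_symmDiff, hi]
    rw [this]; exact measurable_set_notMem i
  · have : (fun ω : BondConfig V => i ∈ ω ∆ {e}) = fun ω => i ∈ ω := by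
      funext ω; apply propext; simp [Set.mem_symmDiff, hi]
    rw [this]; exact measurable_set_mem i

/-- **Flipping the edge `e ∈ G.edgeSet` preserves `P_{1/2}`.** -/
theorem bondPercolation_half_map_toggle [Countable V] (G : SimpleGraph V) {e : Sym2 V} (he : e ∈ G.edgeSet) :
    (bondPercolation G half).map (fun ω : BondConfig V => ω ∆ {e}) = bondPercolation G half := by
  set ν : Sym2 V → Measure Prop := fun i => toNNReal half • dirac (i ∈ G.edgeSet) + toNNReal (σ half) • dirac False
    with hν
  set f : (i : Sym2 V) → Prop → Prop := fun i P => (P ↔ i ≠ e) with hf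
  have hhalf : σ half = half := Subtype.ext (by rw [unitInterval.coe_symm_eq, coe_half]; norm_num)
  have hν' : (fun i => (ν i).map (f i)) = ν := by
    funext i
    by_cases hi : i = e
    · rw [hi]
      simp only [hν, hf]
      rw [Measure.map_add _ _ Measurable.of_discrete, Measure.map_smul, Measure.map_smul,
        Measure.map_dirac' Measurable.of_discrete, Measure.map_dirac' Measurable.of_discrete]
      have h1 : ((e ∈ G.edgeSet) ↔ e ≠ e) = False := propext ⟨fun h => (h.1 he) rfl, False.elim⟩
      have h2 : (False ↔ e ≠ e) = (e ∈ G.edgeSet) := propext ⟨fun _ => he, fun _ => ⟨False.elim, fun h => h rfl⟩⟩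
      rw [h1, h2, hhalf, add_comm]
    · have : f i = id := by funext P; exact propext (iff_true_right hi)
      rw [this, Measure.map_id]
  have hcomm : (fun ω : BondConfig V => ω ∆ {e}) ∘ (fun q : Sym2 V → Prop => {i | q i}) =
      (fun q : Sym2 V → Prop => {i | q i}) ∘ (fun x i => f i (x i)) := by
    funext q
    simp only [Function.comp_apply, hf]
    exact (setOf_flipCoord_eq e q).symm
  have hmf : Measurable (fun (x : Sym2 V → Prop) i => f i (x i)) :=
    measurable_pi_lambda _ fun i => (Measurable.of_discrete : Measurable (f i)).comp (measurable_pi_apply i)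
  rw [bondPercolation, setBernoulli_eq_map, Measure.map_map (measurable_toggle e) measurable_setOf, hcomm,
    ← Measure.map_map measurable_setOf hmf, Measure.infinitePi_map_pi, hν']
  exact fun i => Measurable.of_discrete

/-- **Flipping one edge does not change expectations under `P_{1/2}`.** -/
theorem integral_toggle_half [Countable V] (G : SimpleGraph V) {e : Sym2 V} (he : e ∈ G.edgeSet)
    {F : BondConfig V → ℂ} (hF : AEStronglyMeasurable F (bondPercolation G half)) :
    ∫ ω, F (ω ∆ {e}) ∂(bondPercolation G half) = ∫ ω, F ω ∂(bondPercolation G half) := by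
  have hmap := bondPercolation_half_map_toggle G he
  have hF' : AEStronglyMeasurable F ((bondPercolation G half).map (fun ω : BondConfig V => ω ∆ {e})) := by
    rwa [hmap]
  rw [← integral_map (measurable_toggle e).aemeasurable hF', hmap]

/-- **Flip invariance of expectations under `P_{1/2}`, registered form** (glue sub-goal
`integralToggleHalf` of the line). -/
theorem integralToggleHalf : ∀ (V : Type) [Countable V] (G : SimpleGraph V) (e : Sym2 V) (F : BondConfig V → ℂ), e ∈ G.edgeSet → MeasureTheory.AEStronglyMeasurable F (bondPercolation G half) → ∫ ω, F (symmDiff ω {e}) ∂(bondPercolation G half) = ∫ ω, F ω ∂(bondPercolation G half) :=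
  fun _ _ G _ _ he hF => integral_toggle_half G he hF

end Summit.CriticalPhenomena.CardyFormulaZ2.Cruxes.CoherentMorera.FinitaryGreenPairing

end
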